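import Summits.HodgeConjecture.HodgeCM.Automorphic.WeilThetaModelHeisenbergAdjoin_1

/-! PORT of `HodgeCM/Automorphic/WeilThetaModelHeisenbergAdjoin.lean` (HodgeCMPerL run 82) — part 2: continuation of `Summits.HodgeConjecture.HodgeCM.Automorphic.WeilThetaModelHeisenbergAdjoin_1` (split at a top-level declaration boundary by port_pkg.py; scope re-opened below; declarations unchanged). -/

-- port_pkg: scope re-opened for this part (file-level context, then the namespace/section stack open at the cut)
set_option autoImplicit false
noncomputable section
open Topology MeasureTheory
open scoped RealInnerProductSpace FourierTransform SchwartzMap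
namespace HodgeCM
namespace SchwartzWeil
section Arith
variable (V : Type) [NormedAddCommGroup V] [InnerProductSpace ℝ V] (L : Submodule ℤ V) (m : ℤ) {D : Type} [Group D]
  (φ : D →* MulAut (Heis V))
variable {φ}
variable (φ)
variable [TopologicalSpace D]
variable [FiniteDimensional ℝ V] [DiscreteTopology L] [IsZLattice ℝ L] [NeZero m]
variable {φ} [DiscreteTopology D]
/-- **`arithSD` is DISCRETE** when `D` preserves `arith` (full lattice `L`, `m ≠ 0`): it embeds continuously into
the discrete `arith × D` (#7). -/
theorem discreteTopology_arithSD (hφa : PreservesArith V L m φ) : DiscreteTopology (arithSD V L m φ) := by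
  refine DiscreteTopology.of_continuous_injective
    (f := fun x : arithSD V L m φ =>
      ((⟨x.1.left, left_mem_arith_of_mem_arithSD V L m hφa x.2⟩ : arith V L m), x.1.right)) ?_ ?_
  · exact ((HeisSD.continuous_left.comp continuous_subtype_val).subtype_mk _).prodMk
      (HeisSD.continuous_right.comp continuous_subtype_val)
  · intro x y h
    simp only [Prod.mk.injEq, Subtype.mk.injEq] at h
    exact Subtype.ext (SemidirectProduct.ext h.1 h.2)

end Arith

/-! ## 4. Weil's theta function on `Heis V ⋊[φ] D` and its invariance -/

section Theta

variable (V : Type) [NormedAddCommGroup V] [InnerProductSpace ℝ V] [FiniteDimensional ℝ V] [MeasurableSpace V]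
  [BorelSpace V] (L : Submodule ℤ V) (m : ℤ) {D : Type} [Group D] {φ : D →* MulAut (Heis V)}
  {π : D →* (𝓢(V, ℂ) →L[ℂ] 𝓢(V, ℂ))ˣ}

/-- **Weil's theta function on the extended group**: `Θ̃_Φ(x) := Θ_{ρ̃(x)Φ}(1) = Σ_{v ∈ L} (ρ̃(x) Φ)(v)`. -/
def thetaSD (hc : Intertwines V m φ π) (Φ : 𝓢(V, ℂ)) (x : Heis V ⋊[φ] D) : ℂ :=
  thetaH V L m ((repSD V m hc x : 𝓢(V, ℂ) →L[ℂ] 𝓢(V, ℂ)) Φ) 1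

/-- (Ported verbatim from the HodgeCMPerL package; no docstring in the source.) -/
theorem thetaSD_def (hc : Intertwines V m φ π) (Φ : 𝓢(V, ℂ)) (x : Heis V ⋊[φ] D) :
    thetaSD V L m hc Φ x = thetaH V L m ((repSD V m hc x : 𝓢(V, ℂ) →L[ℂ] 𝓢(V, ℂ)) Φ) 1 := rfl

/-- `Θ̃_Φ(h, d) = Θ_{π_d Φ}(h)`. -/
theorem thetaSD_eq (hc : Intertwines V m φ π) (Φ : 𝓢(V, ℂ)) (x : Heis V ⋊[φ] D) :
    thetaSD V L m hc Φ x = thetaH V L m ((π x.right : 𝓢(V, ℂ) →L[ℂ] 𝓢(V, ℂ)) Φ) x.left := by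
  rw [thetaSD, repSD_val_apply, thetaH_repCLM, one_mul]

/-- On the Heisenberg group it is `Θ` of #5. -/
@[simp] theorem thetaSD_inl (hc : Intertwines V m φ π) (Φ : 𝓢(V, ℂ)) (h : Heis V) :
    thetaSD V L m hc Φ (SemidirectProduct.inl h) = thetaH V L m Φ h := by
  rw [thetaSD, repSD_inl_apply, thetaH_repCLM, one_mul]

/-- At an adjoined element it is `Θ_{π_d Φ}(1)`. -/
theorem thetaSD_inr (hc : Intertwines V m φ π) (Φ : 𝓢(V, ℂ)) (d : D) :
    thetaSD V L m hc Φ (SemidirectProduct.inr d) = thetaH V L m ((π d : 𝓢(V, ℂ) →L[ℂ] 𝓢(V, ℂ)) Φ) 1 := by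
  rw [thetaSD, repSD_inr]

/-- The `theta_act` law: `Θ̃_{ρ̃(g)Φ}(x) = Θ̃_Φ(x g)`. -/
theorem thetaSD_repSD (hc : Intertwines V m φ π) (Φ : 𝓢(V, ℂ)) (x g : Heis V ⋊[φ] D) :
    thetaSD V L m hc ((repSD V m hc g : 𝓢(V, ℂ) →L[ℂ] 𝓢(V, ℂ)) Φ) x = thetaSD V L m hc Φ (x * g) := by
  rw [thetaSD, thetaSD, repSD_mul_apply]

/-- The stabiliser of the theta distribution `Φ ↦ Θ_Φ(1)` under `ρ̃`. -/
def thetaStabSD (hc : Intertwines V m φ π) : Subgroup (Heis V ⋊[φ] D) where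
  carrier := {x | ∀ Ψ : 𝓢(V, ℂ),
    thetaH V L m ((repSD V m hc x : 𝓢(V, ℂ) →L[ℂ] 𝓢(V, ℂ)) Ψ) 1 = thetaH V L m Ψ 1}
  one_mem' Ψ := by rw [repSD_one_apply]
  mul_mem' {x y} hx hy Ψ := by rw [repSD_mul_apply, hx, hy]
  inv_mem' {x} hx Ψ := by
    rw [← hx ((repSD V m hc x⁻¹ : 𝓢(V, ℂ) →L[ℂ] 𝓢(V, ℂ)) Ψ), ← repSD_mul_apply, mul_inv_cancel, repSD_one_apply]

/-- (Ported verbatim from the HodgeCMPerL package; no docstring in the source.) -/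
theorem mem_thetaStabSD (hc : Intertwines V m φ π) {x : Heis V ⋊[φ] D} :
    x ∈ thetaStabSD V L m hc ↔
      ∀ Ψ : 𝓢(V, ℂ), thetaH V L m ((repSD V m hc x : 𝓢(V, ℂ) →L[ℂ] 𝓢(V, ℂ)) Ψ) 1 = thetaH V L m Ψ 1 :=
  Iff.rfl

/-- Left invariance of `Θ̃` under the stabiliser. -/
theorem thetaSD_stab_mul (hc : Intertwines V m φ π) (Φ : 𝓢(V, ℂ)) {γ : Heis V ⋊[φ] D}
    (hγ : γ ∈ thetaStabSD V L m hc) (x : Heis V ⋊[φ] D) : thetaSD V L m hc Φ (γ * x) = thetaSD V L m hc Φ x := by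
  rw [thetaSD, thetaSD, repSD_mul_apply, hγ]

/-- `arith ≤ stabiliser` (Weil's Théorème 6 for the Heisenberg part, #5). -/
theorem inl_mem_thetaStabSD (hc : Intertwines V m φ π) {γ : Heis V} (hγ : γ ∈ arith V L m) :
    (SemidirectProduct.inl γ : Heis V ⋊[φ] D) ∈ thetaStabSD V L m hc := fun Ψ => by
  rw [repSD_inl_apply, thetaH_repCLM, one_mul, ← mul_one γ, thetaH_arith_mul V L m Ψ hγ]

variable (π)

/-- **The adjoined operators fix the theta distribution of `L`**: `Σ_{v ∈ L} (π_d Ψ)(v) = Σ_{v ∈ L} Ψ(v)`. -/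
def FixesTheta : Prop :=
  ∀ (d : D) (Ψ : 𝓢(V, ℂ)), thetaH V L m ((π d : 𝓢(V, ℂ) →L[ℂ] 𝓢(V, ℂ)) Ψ) 1 = thetaH V L m Ψ 1

variable {π}

/-- (Ported verbatim from the HodgeCMPerL package; no docstring in the source.) -/
theorem inr_mem_thetaStabSD (hc : Intertwines V m φ π) (hθ : FixesTheta V L m π) (d : D) :
    (SemidirectProduct.inr d : Heis V ⋊[φ] D) ∈ thetaStabSD V L m hc := fun Ψ => by
  rw [repSD_inr, hθ]

/-- **Théorème 6 for the extended group**: `arithSD ≤ stabiliser`. -/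
theorem arithSD_le_thetaStabSD (hc : Intertwines V m φ π) (hθ : FixesTheta V L m π) :
    arithSD V L m φ ≤ thetaStabSD V L m hc :=
  sup_le (Subgroup.map_le_iff_le_comap.mpr fun _ hγ => inl_mem_thetaStabSD V L m hc hγ)
    (Subgroup.map_le_iff_le_comap.mpr fun d _ => inr_mem_thetaStabSD V L m hc hθ d)

/-- **Left `arithSD`-invariance of `Θ̃`**: `Θ̃_Φ(γ x) = Θ̃_Φ(x)`, `γ ∈ ⟨arith, D⟩`. -/
theorem thetaSD_arithSD_mul (hc : Intertwines V m φ π) (hθ : FixesTheta V L m π) (Φ : 𝓢(V, ℂ))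
    {γ : Heis V ⋊[φ] D} (hγ : γ ∈ arithSD V L m φ) (x : Heis V ⋊[φ] D) :
    thetaSD V L m hc Φ (γ * x) = thetaSD V L m hc Φ x :=
  thetaSD_stab_mul V L m hc Φ (arithSD_le_thetaStabSD V L m hc hθ hγ) x

/-- `Θ̃_Φ(d) = Θ_Φ(1)`: the theta distribution is fixed by every adjoined element. -/
theorem thetaSD_inr_eq (hc : Intertwines V m φ π) (hθ : FixesTheta V L m π) (Φ : 𝓢(V, ℂ)) (d : D) :
    thetaSD V L m hc Φ (SemidirectProduct.inr d) = thetaSD V L m hc Φ 1 := by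
  rw [← mul_one (SemidirectProduct.inr d : Heis V ⋊[φ] D), thetaSD_arithSD_mul V L m hc hθ Φ
    (inr_mem_arithSD V L m φ d)]

variable [TopologicalSpace D] [DiscreteTopology D] [DiscreteTopology L]

/-- Joint continuity of `(Φ, x) ↦ Θ̃_Φ(x)`. -/
theorem continuous_thetaSD_uncurry (hc : Intertwines V m φ π) : Continuous (Function.uncurry (thetaSD V L m hc)) := by
  have h := (continuous_thetaH_left V L m (1 : Heis V)).comp
    ((continuous_repSD_uncurry V m hc).comp
      ((continuous_snd (X := 𝓢(V, ℂ)) (Y := Heis V ⋊[φ] D)).prodMk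
        (continuous_fst (X := 𝓢(V, ℂ)) (Y := Heis V ⋊[φ] D))))
  simp only [Function.comp_def, Function.uncurry_def] at h
  exact h

/-- (Ported verbatim from the HodgeCMPerL package; no docstring in the source.) -/
theorem continuous_thetaSD (hc : Intertwines V m φ π) (Φ : 𝓢(V, ℂ)) : Continuous (thetaSD V L m hc Φ) := by
  have h := (continuous_thetaSD_uncurry V L m hc).comp
    ((continuous_const (y := Φ)).prodMk (continuous_id (X := Heis V ⋊[φ] D)))
  simp only [Function.comp_def, Function.uncurry_def, id] at h
  exact h

/-- (Ported verbatim from the HodgeCMPerL package; no docstring in the source.) -/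
theorem continuous_thetaSD_left (hc : Intertwines V m φ π) (x : Heis V ⋊[φ] D) :
    Continuous fun Φ : 𝓢(V, ℂ) => thetaSD V L m hc Φ x := by
  have h := (continuous_thetaSD_uncurry V L m hc).comp
    ((continuous_id (X := 𝓢(V, ℂ))).prodMk (continuous_const (y := x)))
  simp only [Function.comp_def, Function.uncurry_def, id] at h
  exact h

end Theta

/-! ## 5. The Weil theta model on `Heis V ⋊[φ] D` -/

section Model

variable (V : Type) [NormedAddCommGroup V] [InnerProductSpace ℝ V] [FiniteDimensional ℝ V] [MeasurableSpace V]
  [BorelSpace V] (L : Submodule ℤ V) (m : ℤ) {D : Type} [Group D] [TopologicalSpace D]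
  {φ : D →* MulAut (Heis V)} {π : D →* (𝓢(V, ℂ) →L[ℂ] 𝓢(V, ℂ))ˣ}

/-- The datum: `Mp := Heis V ⋊[φ] D`, `SX := 𝓢(V, ℂ)`, `act := ρ̃`, `rat := arithSD`, `theta := Θ̃`. -/
def datumSD (hc : Intertwines V m φ π) : Literature.Theta.WeilThetaDatum.{0} where
  Mp := Heis V ⋊[φ] D
  SX := 𝓢(V, ℂ)
  act := fun x Φ => (repSD V m hc x : 𝓢(V, ℂ) →L[ℂ] 𝓢(V, ℂ)) Φ
  rat := (arithSD V L m φ : Set (Heis V ⋊[φ] D))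
  theta := thetaSD V L m hc

/-- (Ported verbatim from the HodgeCMPerL package; no docstring in the source.) -/
@[simp] theorem datumSD_Mp (hc : Intertwines V m φ π) : (datumSD V L m hc).Mp = (Heis V ⋊[φ] D) := rfl

/-- (Ported verbatim from the HodgeCMPerL package; no docstring in the source.) -/
@[simp] theorem datumSD_SX (hc : Intertwines V m φ π) : (datumSD V L m hc).SX = 𝓢(V, ℂ) := rfl

/-- (Ported verbatim from the HodgeCMPerL package; no docstring in the source.) -/
theorem datumSD_act (hc : Intertwines V m φ π) (x : Heis V ⋊[φ] D) (Φ : 𝓢(V, ℂ)) :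
    (datumSD V L m hc).act x Φ = (repSD V m hc x : 𝓢(V, ℂ) →L[ℂ] 𝓢(V, ℂ)) Φ := rfl

/-- (Ported verbatim from the HodgeCMPerL package; no docstring in the source.) -/
theorem datumSD_theta (hc : Intertwines V m φ π) : (datumSD V L m hc).theta = thetaSD V L m hc := rfl

/-- (Ported verbatim from the HodgeCMPerL package; no docstring in the source.) -/
theorem datumSD_rat (hc : Intertwines V m φ π) :
    (datumSD V L m hc).rat = (arithSD V L m φ : Set (Heis V ⋊[φ] D)) := rfl

variable [DiscreteTopology D]

/-- (Ported verbatim from the HodgeCMPerL package; no docstring in the source.) -/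
theorem actionContinuousSD (hc : Intertwines V m φ π) : (datumSD V L m hc).ActionContinuous :=
  continuous_repSD_uncurry V m hc

variable [DiscreteTopology L]

/-- (Ported verbatim from the HodgeCMPerL package; no docstring in the source.) -/
theorem thetaContinuousInvariantSD (hc : Intertwines V m φ π) (hθ : FixesTheta V L m π) :
    (datumSD V L m hc).ThetaContinuousInvariant :=
  ⟨continuous_thetaSD V L m hc, fun Φ _ hγ x => thetaSD_arithSD_mul V L m hc hθ Φ hγ x⟩

variable [IsTopologicalGroup (Heis V ⋊[φ] D)]

/-- **The Weil theta model on the Heisenberg group WITH A DISCRETE GROUP `D` OF INTERTWINERS ADJOINED.**  Data: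
`φ : D →* MulAut (Heis V)` by automorphisms fixing the centre and making `Heis V ⋊[φ] D` a topological group
(`HeisSD.isTopologicalGroup`: it suffices that they are continuous), `π : D →* End(𝓢(V, ℂ))ˣ` intertwining
`ρ_m` along `φ` and fixing the theta distribution of `L`; a weight `m` and a subgroup `Γ ≤ U(1)` of `m`-th roots of
unity.  Result: prl1-g4's `WeilThetaModel (Heis V ⋊[φ] D) ⟨arith, D⟩ U(1) Γ` with every field a theorem — the
adjoined elements ACT (by `π`) and `Θ̃` is invariant under them. -/
def heisenbergAdjoinModel (hφc : ∀ (d : D) (z : Circle), φ d (Heis.center z) = Heis.center z) (hc : Intertwines V m φ π)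
    (hθ : FixesTheta V L m π) (Γ : Subgroup Circle) (hΓ : ∀ u ∈ Γ, u ^ m = 1) :
    HodgeCM.WeilThetaModel (Heis V ⋊[φ] D) (arithSD V L m φ) Circle Γ where
  W := datumSD V L m hc
  act_one := repSD_one_apply V m hc
  theta_act := fun Φ x g => thetaSD_repSD V L m hc Φ x g
  actionContinuous := actionContinuousSD V L m hc
  thetaContinuousInvariant := thetaContinuousInvariantSD V L m hc hθ
  dist_cont := continuous_thetaSD_left V L m hc 1
  s := HeisSD.splitting hφc
  s_cont := HeisSD.continuous_splitting hφc
  s_rat := fun _ hγU _ hγ => (arithSD V L m φ).mul_mem hγU (center_mem_arithSD V L m φ (hΓ _ hγ))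
  SK := Set.univ
  SK_stable := fun _ _ _ => Set.mem_univ _

/-- (Ported verbatim from the HodgeCMPerL package; no docstring in the source.) -/
@[simp] theorem heisenbergAdjoinModel_W (hφc : ∀ (d : D) (z : Circle), φ d (Heis.center z) = Heis.center z) (hc : Intertwines V m φ π)
    (hθ : FixesTheta V L m π) (Γ : Subgroup Circle) (hΓ : ∀ u ∈ Γ, u ^ m = 1) :
    (heisenbergAdjoinModel V L m hφc hc hθ Γ hΓ).W = datumSD V L m hc := rfl

/-- (Ported verbatim from the HodgeCMPerL package; no docstring in the source.) -/
@[simp] theorem heisenbergAdjoinModel_SK (hφc : ∀ (d : D) (z : Circle), φ d (Heis.center z) = Heis.center z) (hc : Intertwines V m φ π)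
    (hθ : FixesTheta V L m π) (Γ : Subgroup Circle) (hΓ : ∀ u ∈ Γ, u ^ m = 1) :
    (heisenbergAdjoinModel V L m hφc hc hθ Γ hΓ).SK = Set.univ := rfl

/-- The model's theta kernel on representatives: `θ_Φ(x·arithSD, zΓ) = Θ̃_Φ(x⁻¹ c(z⁻¹))`. -/
theorem heisenbergAdjoinModel_θ_mk (hφc : ∀ (d : D) (z : Circle), φ d (Heis.center z) = Heis.center z) (hc : Intertwines V m φ π)
    (hθ : FixesTheta V L m π) (Γ : Subgroup Circle) (hΓ : ∀ u ∈ Γ, u ^ m = 1) (Φ : 𝓢(V, ℂ)) (x : Heis V ⋊[φ] D)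
    (z : Circle) :
    (heisenbergAdjoinModel V L m hφc hc hθ Γ hΓ).θ ⟨Φ, Set.mem_univ Φ⟩ (QuotientGroup.mk x, QuotientGroup.mk z) =
      thetaSD V L m hc Φ (x⁻¹ * HeisSD.center z⁻¹) := by
  rw [WeilThetaModel.θ_mk]
  rfl

/-- **Consistency with #5**: on the Heisenberg group the new kernel IS the old one. -/
theorem heisenbergAdjoinModel_θ_mk_inl (hφc : ∀ (d : D) (z : Circle), φ d (Heis.center z) = Heis.center z) (hc : Intertwines V m φ π)
    (hθ : FixesTheta V L m π) (Γ : Subgroup Circle) (hΓ : ∀ u ∈ Γ, u ^ m = 1) (Φ : 𝓢(V, ℂ)) (h : Heis V)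
    (z : Circle) :
    (heisenbergAdjoinModel V L m hφc hc hθ Γ hΓ).θ ⟨Φ, Set.mem_univ Φ⟩
        (QuotientGroup.mk (SemidirectProduct.inl h), QuotientGroup.mk z) =
      (heisenbergModel V L m Γ hΓ).θ ⟨Φ, Set.mem_univ Φ⟩ (QuotientGroup.mk h, QuotientGroup.mk z) := by
  rw [heisenbergAdjoinModel_θ_mk, heisenbergModel_θ_mk, HeisSD.center_apply, ← map_inv, ← map_mul, thetaSD_inl]

/-- **The adjoined elements are absorbed**: `θ_Φ((x d)·arithSD, q) = θ_Φ(x·arithSD, q)` for every `d ∈ D`. -/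
theorem heisenbergAdjoinModel_θ_inr_mul (hφc : ∀ (d : D) (z : Circle), φ d (Heis.center z) = Heis.center z) (hc : Intertwines V m φ π)
    (hθ : FixesTheta V L m π) (Γ : Subgroup Circle) (hΓ : ∀ u ∈ Γ, u ^ m = 1)
    (Φ : (heisenbergAdjoinModel V L m hφc hc hθ Γ hΓ).SK) (x : Heis V ⋊[φ] D) (d : D) (q : Circle ⧸ Γ) :
    (heisenbergAdjoinModel V L m hφc hc hθ Γ hΓ).θ Φ (QuotientGroup.mk (x * SemidirectProduct.inr d), q) =
      (heisenbergAdjoinModel V L m hφc hc hθ Γ hΓ).θ Φ (QuotientGroup.mk x, q) := by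
  rw [QuotientGroup.mk_mul_of_mem x (inr_mem_arithSD V L m φ d)]

/-- Non-degeneracy survives. -/
theorem heisenbergAdjoinModel_θ_ne_zero (hφc : ∀ (d : D) (z : Circle), φ d (Heis.center z) = Heis.center z) (hc : Intertwines V m φ π)
    (hθ : FixesTheta V L m π) (Γ : Subgroup Circle) (hΓ : ∀ u ∈ Γ, u ^ m = 1) :
    ∃ Φ : (heisenbergAdjoinModel V L m hφc hc hθ Γ hΓ).SK,
      (heisenbergAdjoinModel V L m hφc hc hθ Γ hΓ).θ Φ (QuotientGroup.mk 1, QuotientGroup.mk 1) ≠ 0 := by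
  obtain ⟨Φ, hΦ⟩ := heisenbergModel_θ_ne_zero V L m Γ hΓ
  refine ⟨⟨Φ.1, Set.mem_univ _⟩, ?_⟩
  have h1 : (1 : Heis V ⋊[φ] D) = SemidirectProduct.inl 1 := (map_one _).symm
  rw [h1, heisenbergAdjoinModel_θ_mk_inl]
  exact hΦ

/-- The three structural laws of prl1-g4's record for the extended model. -/
theorem heisenbergAdjoinModel_structural_laws (hφc : ∀ (d : D) (z : Circle), φ d (Heis.center z) = Heis.center z) (hc : Intertwines V m φ π)
    (hθ : FixesTheta V L m π) (Γ : Subgroup Circle) (hΓ : ∀ u ∈ Γ, u ^ m = 1) :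
    (∀ Φ : (heisenbergAdjoinModel V L m hφc hc hθ Γ hΓ).SK,
        (heisenbergAdjoinModel V L m hφc hc hθ Γ hΓ).omg 1 Φ = Φ) ∧
      Continuous (heisenbergAdjoinModel V L m hφc hc hθ Γ hΓ).θ ∧
      ∀ (z : Circle) (Φ : (heisenbergAdjoinModel V L m hφc hc hθ Γ hΓ).SK)
        (ξ : (Heis V ⋊[φ] D) ⧸ arithSD V L m φ) (q : Circle ⧸ Γ),
        (heisenbergAdjoinModel V L m hφc hc hθ Γ hΓ).θ ((heisenbergAdjoinModel V L m hφc hc hθ Γ hΓ).omg z Φ)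
            (ξ, q) =
          (heisenbergAdjoinModel V L m hφc hc hθ Γ hΓ).θ Φ (ξ, z⁻¹ • q) :=
  (heisenbergAdjoinModel V L m hφc hc hθ Γ hΓ).structural_laws

end Model

/-! ## 6. The lattice junction: `(Heis V ⋊[φ] D, arith ⋊ D)` is a cocompact lattice model -/

section Lattice

variable (V : Type) [NormedAddCommGroup V] [InnerProductSpace ℝ V] [FiniteDimensional ℝ V] (L : Submodule ℤ V)
  [DiscreteTopology L] [IsZLattice ℝ L] (m : ℤ) [NeZero m] {D : Type} [Group D] [TopologicalSpace D]
  [DiscreteTopology D] [Countable D] {φ : D →* MulAut (Heis V)}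

/-- **`(Heis V ⋊[φ] D, ⟨arith, D⟩)` is a cocompact lattice model** (full lattice `L`, `m ≠ 0`, `D` countable
discrete acting continuously and arithmetically). -/
def heisenbergAdjoinLatticeModel (hφ : ∀ d : D, Continuous (φ d : Heis V → Heis V))
    (hφa : PreservesArith V L m φ) : CocompactLatticeModel :=
  haveI := HeisSD.isTopologicalGroup hφ
  haveI := HeisSD.locallyCompactSpace_of_discrete D
  haveI := discreteTopology_arithSD V L m hφa
  { G := Heis V ⋊[φ] D
    Γ := arithSD V L m φ }

/-- (Ported verbatim from the HodgeCMPerL package; no docstring in the source.) -/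
@[simp] theorem heisenbergAdjoinLatticeModel_G (hφ : ∀ d : D, Continuous (φ d : Heis V → Heis V))
    (hφa : PreservesArith V L m φ) : (heisenbergAdjoinLatticeModel V L m hφ hφa).G = (Heis V ⋊[φ] D) := rfl

/-- (Ported verbatim from the HodgeCMPerL package; no docstring in the source.) -/
@[simp] theorem heisenbergAdjoinLatticeModel_Γ (hφ : ∀ d : D, Continuous (φ d : Heis V → Heis V))
    (hφa : PreservesArith V L m φ) : (heisenbergAdjoinLatticeModel V L m hφ hφa).Γ = arithSD V L m φ := rfl

variable [MeasurableSpace V] [BorelSpace V] {π : D →* (𝓢(V, ℂ) →L[ℂ] 𝓢(V, ℂ))ˣ}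

/-- **The model of §5 over the carriers of the lattice model** (so that LatticeModelThetaData-style consumers can
take `G, Γ` from `heisenbergAdjoinLatticeModel` and the kernel from `heisenbergAdjoinModel`). -/
def heisenbergAdjoinModelOverLattice (hφ : ∀ d : D, Continuous (φ d : Heis V → Heis V))
    (hφc : ∀ (d : D) (z : Circle), φ d (Heis.center z) = Heis.center z) (hφa : PreservesArith V L m φ)
    (hc : Intertwines V m φ π) (hθ : FixesTheta V L m π) (Γ : Subgroup Circle) [Finite Γ]
    (hΓ : ∀ u ∈ Γ, u ^ m = 1) :
    HodgeCM.WeilThetaModel (heisenbergAdjoinLatticeModel V L m hφ hφa).toQuotientModel.G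
      (heisenbergAdjoinLatticeModel V L m hφ hφa).toQuotientModel.Γ (circleLatticeModel Γ).toQuotientModel.G
      (circleLatticeModel Γ).toQuotientModel.Γ :=
  haveI := HeisSD.isTopologicalGroup hφ
  heisenbergAdjoinModel V L m hφc hc hθ Γ hΓ

/-- (Ported verbatim from the HodgeCMPerL package; no docstring in the source.) -/
theorem heisenbergAdjoinModelOverLattice_θ_ne_zero (hφ : ∀ d : D, Continuous (φ d : Heis V → Heis V))
    (hφc : ∀ (d : D) (z : Circle), φ d (Heis.center z) = Heis.center z) (hφa : PreservesArith V L m φ)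
    (hc : Intertwines V m φ π) (hθ : FixesTheta V L m π) (Γ : Subgroup Circle) [Finite Γ]
    (hΓ : ∀ u ∈ Γ, u ^ m = 1) :
    ∃ Φ, (heisenbergAdjoinModelOverLattice V L m hφ hφc hφa hc hθ Γ hΓ).θ Φ
      (QuotientGroup.mk 1, QuotientGroup.mk 1) ≠ 0 := by
  haveI := HeisSD.isTopologicalGroup hφ
  exact heisenbergAdjoinModel_θ_ne_zero V L m hφc hc hθ Γ hΓ

end Lattice

end SchwartzWeil
end HodgeCM

-- port_pkg: scope closed for this part
end
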